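import Summits.Schanuel.Schanuel.Theorems.SoloInformedRoyAdditiveDirichlet
import Literature.NumberTheory.Transcendental.GelfondCriterionProofs
import HarnessLib.Audit.Tags

/-!
# Roy's additive small value estimates: the one-point Gel'fond ceiling (soloist)

Soloist file (`solo-Schanuel-informed`, s149, 2026-08-29), third of the toy-layer files
`SoloInformedBoxPrinciple` → `SoloInformedRoyAdditiveDirichlet` → this one.
Sources: [Roy2010 = D. Roy, *Small value estimates for the additive group*, Int. J. Number
Theory **6** (2010), arXiv:0708.2307, §1 and Lemma 2.2]; the tree's PROVED Gel'fond criterion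
`Literature.NumberTheory.Transcendental.gelfond_criterion_not_small_values` (Chudnovsky's
form with separated degree and type sequences, constant `40`).

## What is proved

Recall (`SoloInformedRoyAdditiveDirichlet`): `RoyAdditiveSmall ξ β σ τ ν n` is the set of
non-zero `P ∈ ℤ[X]`, `deg P ≤ n`, naive height `≤ exp(n^β)`, with `‖P^{[j]}(iξ)‖ ≤ exp(-n^ν)`
for all naturals `i ≤ n^σ`, `j ≤ n^τ`; `royAdditiveSVEExponents ξ β σ τ` is the (upper) set of
`ν` for which these sets are empty for infinitely many `n`; its infimum is the threshold
`ν*(ξ; β, σ, τ)`; the previous file proved `ν* ≥ 1 + β − σ − τ` (Dirichlet) for every `ξ` and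
typed the OPEN node `RoyAdditiveDirichletExponent` (`ν* = 1 + β − σ − τ` for transcendental `ξ`,
`β > 1`, `σ + τ < 1`; Roy proves `ν* ≤ 1 + β − (3/4)σ − τ`).

* §1 MONOTONICITY: the exponent set grows with `σ` and with `τ` (more points and more
  derivatives only make emptiness easier), so `ν*` is non-increasing in each.
* §2 THE ONE-POINT GEL'FOND CEILING (`frequently_not_small_at_point` = Roy's wording for an
  arbitrary sequence `(P_n)`; `Ioi_subset_royAdditiveSVEExponents` = the set form): for
  TRANSCENDENTAL `ξ`, `β ≥ 1`, `σ ≥ 0` (any `τ`), every `ν > 1 + β` is an exponent, i.e.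
  `ν* ≤ 1 + β`.  This is [Roy2010, Lemma 2.2] for `m = 1`, `α = 1` ("a direct consequence of
  [Br1]" there) and it is DERIVED here, in the kernel, from the tree's Gel'fond criterion applied
  at the single point `ξ = 1·ξ`, `j = 0`, with degree sequence `N + 1`, type sequence `2(N+1)^β`,
  ratio `a = 2^β + 1`: the criterion yields `‖P_N(ξ)‖ ≥ exp(-80a(N+1)^{1+β})` for some large
  `N ≥ N₁`, incompatible with `‖P_N(ξ)‖ ≤ exp(-N^ν)`, `ν > 1 + β`.
* §3 CONSEQUENCES FOR THE NODE: `RoyAdditiveDirichletExponent` HOLDS AT ITS CORNER `σ = τ = 0`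
  (`royAdditiveDirichletExponent_corner`: there the Dirichlet floor and the Gel'fond ceiling
  meet at `1 + β`; `royAdditiveDirichletExponent_iff_off_corner`: the node is equivalent to its
  restriction to `(σ, τ) ≠ (0, 0)`), and unconditionally the threshold of a transcendental `ξ`
  lies in the KERNEL WINDOW `[1 + β − σ − τ, 1 + β]` (`royAdditiveSVEExponents_window`).  What remains open in the
  node is exactly the DESCENT of `ν*` below the one-point value `1 + β` as points (`σ > 0`) or
  derivatives (`τ > 0`) are added: Roy's Thm 1.1 (3) gives descent at rate `(3/4)σ + τ`, Dirichlet
  forbids more than `σ + τ`.  (The slice `σ = 0, τ > 0` is [Roy2010 §1: "essentially Proposition 1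
  of [LR1]"] = Gel'fond's criterion WITH MULTIPLICITIES, which the tree does not hold; it is not
  claimed here.)

No new definitions; every statement is about the decls of `SoloInformedRoyAdditiveDirichlet`.
-/

namespace Summit.Schanuel.Schanuel.Theorems

open Filter Polynomial

/-! ## §1 Monotonicity in `σ` and `τ` -/

/-- More points / more derivatives shrink the small-value sets (`n ≥ 1`). -/
theorem royAdditiveSmall_anti_points (ξ : ℂ) (β ν : ℝ) {σ σ' τ τ' : ℝ} (hσ : σ ≤ σ') (hτ : τ ≤ τ')
    {n : ℕ} (hn : 1 ≤ n) : RoyAdditiveSmall ξ β σ' τ' ν n ⊆ RoyAdditiveSmall ξ β σ τ ν n := by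
  rintro P ⟨hP0, hdeg, hht, hsmall⟩
  have hn' : (1 : ℝ) ≤ n := by exact_mod_cast hn
  refine ⟨hP0, hdeg, hht, fun i j hi hj => hsmall i j ?_ ?_⟩
  · exact hi.trans (Real.rpow_le_rpow_of_exponent_le hn' hσ)
  · exact hj.trans (Real.rpow_le_rpow_of_exponent_le hn' hτ)

/-- **The exponent set grows with `σ` and `τ`** (the threshold `ν*` is non-increasing in the
number of points and of derivatives). -/
theorem royAdditiveSVEExponents_mono (ξ : ℂ) (β : ℝ) {σ σ' τ τ' : ℝ} (hσ : σ ≤ σ') (hτ : τ ≤ τ') :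
    royAdditiveSVEExponents ξ β σ τ ⊆ royAdditiveSVEExponents ξ β σ' τ' := by
  intro ν hν
  have hν' : ∃ᶠ n : ℕ in atTop, ¬ (RoyAdditiveSmall ξ β σ τ ν n).Nonempty := hν
  show ∃ᶠ n : ℕ in atTop, ¬ (RoyAdditiveSmall ξ β σ' τ' ν n).Nonempty
  refine (Filter.Frequently.and_eventually hν' (eventually_ge_atTop 1)).mono ?_
  rintro n ⟨hno, hn⟩ hne
  exact hno (hne.mono (royAdditiveSmall_anti_points ξ β ν hσ hτ hn))

/-! ## §2 The one-point Gel'fond ceiling `ν* ≤ 1 + β` -/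

/-- Mathlib's sup norm of an integer polynomial is at most its naive height `polyHeight`
(they are in fact equal; only this inequality is used). -/
theorem supNorm_le_polyHeight (P : ℤ[X]) : P.supNorm ≤ (polyHeight P : ℝ) := by
  obtain ⟨i, hi⟩ := P.exists_eq_supNorm
  rw [hi, Int.norm_eq_abs, ← Int.cast_abs, Int.abs_eq_natAbs, Int.cast_natCast]
  exact_mod_cast natAbs_coeff_le_polyHeight P i

/-- Degree and Gel'fond type `deg P + log H(P)` of a non-zero `P` with `deg P ≤ N` and naive
height `≤ exp(N^β)`, `β ≥ 1`: `deg P < N + 1` and `t(P) < 2(N+1)^β`. -/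
theorem gelfondType_lt_of_bounds {β : ℝ} (hβ : 1 ≤ β) {N : ℕ} {P : ℤ[X]} (hP0 : P ≠ 0)
    (hdeg : P.natDegree ≤ N) (hht : (polyHeight P : ℝ) ≤ Real.exp ((N : ℝ) ^ β)) :
    P ≠ 0 ∧ (P.natDegree : ℝ) < (N : ℝ) + 1 ∧ P.gelfondType < 2 * ((N : ℝ) + 1) ^ β := by
  have hdeg' : (P.natDegree : ℝ) ≤ N := by exact_mod_cast hdeg
  refine ⟨hP0, by linarith, ?_⟩
  have hsup1 : 1 ≤ P.supNorm := Polynomial.one_le_supNorm_of_ne_zero hP0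
  have hlog : Real.log P.supNorm ≤ (N : ℝ) ^ β := by
    rw [Real.log_le_iff_le_exp (by linarith)]
    exact (supNorm_le_polyHeight P).trans hht
  have hN0 : (0 : ℝ) ≤ N := Nat.cast_nonneg N
  have h1 : (N : ℝ) + 1 ≤ ((N : ℝ) + 1) ^ β := by
    have h := Real.rpow_le_rpow_of_exponent_le (by linarith : (1 : ℝ) ≤ (N : ℝ) + 1) hβ
    rwa [Real.rpow_one] at h
  have h2 : (N : ℝ) ^ β ≤ ((N : ℝ) + 1) ^ β :=
    Real.rpow_le_rpow hN0 (by linarith) (by linarith)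
  unfold Polynomial.gelfondType
  linarith

/-- **Gel'fond at one point, Roy's wording** [Roy2010, Lemma 2.2, `m = 1`, `α = 1`], derived from
the tree's `gelfond_criterion_not_small_values`: for transcendental `ξ`, `β ≥ 1`, `ν > 1 + β`
and any sequence of eventually non-zero `P_n ∈ ℤ[X]` with `deg P_n ≤ n`, `H(P_n) ≤ exp(n^β)`,
one has `‖P_n(ξ)‖ > exp(-n^ν)` for infinitely many `n`.  (Criterion run with degree sequence
`N + 1`, type sequence `2(N+1)^β`, ratio `a = 2^β + 1`; its lower bound `exp(-80a(N+1)^{1+β})`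
beats `exp(-N^ν)` for large `N`.) -/
theorem frequently_not_small_at_point {ξ : ℂ} (hξ : Transcendental ℚ ξ) {β ν : ℝ} (hβ : 1 ≤ β)
    (hν : 1 + β < ν) (P : ℕ → ℤ[X])
    (hP : ∀ᶠ n : ℕ in atTop,
      P n ≠ 0 ∧ (P n).natDegree ≤ n ∧ (polyHeight (P n) : ℝ) ≤ Real.exp ((n : ℝ) ^ β)) :
    ∃ᶠ n : ℕ in atTop, Real.exp (-(n : ℝ) ^ ν) < ‖aeval ξ (P n)‖ := by
  by_contra hcon
  have hev : ∀ᶠ n : ℕ in atTop, ‖aeval ξ (P n)‖ ≤ Real.exp (-(n : ℝ) ^ ν) :=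
    (Filter.not_frequently.mp hcon).mono fun n hn => not_lt.mp hn
  have hβ0 : 0 < β := by linarith
  -- the ratio `a = 2^β + 1` of the criterion
  have h2β : (1 : ℝ) ≤ (2 : ℝ) ^ β := Real.one_le_rpow (by norm_num) hβ0.le
  set a : ℝ := (2 : ℝ) ^ β + 1 with ha_def
  have ha : 1 < a := by linarith
  have ha2 : 2 ≤ a := by linarith
  have ha0 : 0 < a := by linarith
  -- eventually the criterion's lower bound beats `exp(-n^ν)`
  have hgrow : ∀ᶠ n : ℕ in atTop,
      (160 * a * (2 : ℝ) ^ β + 1) * (n : ℝ) ^ (1 + β) ≤ (n : ℝ) ^ ν :=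
    eventually_const_mul_rpow_le_rpow hν _
  obtain ⟨N₁, hN₁⟩ :=
    Filter.eventually_atTop.mp (hP.and (hev.and (hgrow.and (eventually_ge_atTop 1))))
  -- the two sequences of the criterion
  have hδm : Monotone (fun N : ℕ => (N : ℝ) + 1) := fun x y h => by
    have : (x : ℝ) ≤ y := Nat.cast_le.mpr h
    show (x : ℝ) + 1 ≤ (y : ℝ) + 1
    linarith
  have hsm : Monotone (fun N : ℕ => 2 * ((N : ℝ) + 1) ^ β) := fun x y h => by
    have : (x : ℝ) ≤ y := Nat.cast_le.mpr h
    show 2 * ((x : ℝ) + 1) ^ β ≤ 2 * ((y : ℝ) + 1) ^ β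
    exact mul_le_mul_of_nonneg_left (Real.rpow_le_rpow (by positivity) (by linarith) hβ0.le)
      (by norm_num)
  have hδ0 : ∀ N : ℕ, 0 < (N : ℝ) + 1 := fun N => by positivity
  have hs0 : ∀ N : ℕ, 0 < 2 * ((N : ℝ) + 1) ^ β := fun N => by positivity
  have hs : Tendsto (fun N : ℕ => 2 * ((N : ℝ) + 1) ^ β) atTop atTop :=
    ((tendsto_rpow_atTop hβ0).comp
      (tendsto_atTop_add_const_right atTop (1 : ℝ) tendsto_natCast_atTop_atTop)).const_mul_atTop
      two_pos
  have hδa : ∀ N : ℕ, ((N + 1 : ℕ) : ℝ) + 1 ≤ a * ((N : ℝ) + 1) := fun N => by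
    push_cast
    have : 2 * ((N : ℝ) + 1) ≤ a * ((N : ℝ) + 1) :=
      mul_le_mul_of_nonneg_right ha2 (by positivity)
    linarith
  have hsa : ∀ N : ℕ, 2 * (((N + 1 : ℕ) : ℝ) + 1) ^ β < a * (2 * ((N : ℝ) + 1) ^ β) := fun N => by
    push_cast
    have hpos : 0 < ((N : ℝ) + 1) ^ β := by positivity
    have h1 : ((N : ℝ) + 1 + 1) ^ β ≤ (2 * ((N : ℝ) + 1)) ^ β :=
      Real.rpow_le_rpow (by positivity) (by linarith) hβ0.le
    rw [Real.mul_rpow (by norm_num) (by positivity)] at h1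
    have h2 : (2 : ℝ) ^ β * ((N : ℝ) + 1) ^ β < a * ((N : ℝ) + 1) ^ β :=
      mul_lt_mul_of_pos_right (by linarith) hpos
    linarith
  have hPcrit : ∀ N, N₁ ≤ N → P N ≠ 0 ∧ ((P N).natDegree : ℝ) < (N : ℝ) + 1 ∧
      (P N).gelfondType < 2 * ((N : ℝ) + 1) ^ β := fun N hN =>
    gelfondType_lt_of_bounds hβ (hN₁ N hN).1.1 (hN₁ N hN).1.2.1 (hN₁ N hN).1.2.2
  -- Gel'fond's criterion: some `P N`, `N ≥ N₁`, is not that small at `ξ`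
  obtain ⟨N, hNN₁, hlow⟩ :=
    Literature.NumberTheory.Transcendental.gelfond_criterion_not_small_values hξ a ha
      (fun N : ℕ => (N : ℝ) + 1) (fun N : ℕ => 2 * ((N : ℝ) + 1) ^ β) hδm hsm hδ0 hs0 hs hδa hsa
      P N₁ hPcrit
  obtain ⟨-, hup, hgrowN, hN1⟩ := hN₁ N hNN₁
  have hn1 : (1 : ℝ) ≤ N := by exact_mod_cast hN1
  have hn0 : (0 : ℝ) < N := by linarith
  -- compare the two bounds
  have hcmp : Real.exp (-40 * a * ((N : ℝ) + 1) * (2 * ((N : ℝ) + 1) ^ β)) ≤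
      Real.exp (-(N : ℝ) ^ ν) := hlow.trans hup
  rw [Real.exp_le_exp] at hcmp
  have hpow : ((N : ℝ) + 1) ^ β ≤ (2 : ℝ) ^ β * (N : ℝ) ^ β := by
    rw [← Real.mul_rpow (by norm_num) hn0.le]
    exact Real.rpow_le_rpow (by positivity) (by linarith) hβ0.le
  have hprod : ((N : ℝ) + 1) * ((N : ℝ) + 1) ^ β ≤ (2 * (N : ℝ)) * ((2 : ℝ) ^ β * (N : ℝ) ^ β) :=
    mul_le_mul (by linarith) hpow (by positivity) (by positivity)
  have hsplit : (N : ℝ) ^ (1 + β) = (N : ℝ) * (N : ℝ) ^ β := by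
    rw [Real.rpow_add hn0, Real.rpow_one]
  have hNβ1 : 0 < (N : ℝ) ^ (1 + β) := Real.rpow_pos_of_pos hn0 _
  have hbig : 40 * a * ((N : ℝ) + 1) * (2 * ((N : ℝ) + 1) ^ β) ≤
      160 * a * (2 : ℝ) ^ β * (N : ℝ) ^ (1 + β) := by
    rw [hsplit]
    have h80 : (0 : ℝ) ≤ 80 * a := by linarith
    calc 40 * a * ((N : ℝ) + 1) * (2 * ((N : ℝ) + 1) ^ β)
        = (80 * a) * (((N : ℝ) + 1) * ((N : ℝ) + 1) ^ β) := by ring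
      _ ≤ (80 * a) * ((2 * (N : ℝ)) * ((2 : ℝ) ^ β * (N : ℝ) ^ β)) :=
          mul_le_mul_of_nonneg_left hprod h80
      _ = 160 * a * (2 : ℝ) ^ β * ((N : ℝ) * (N : ℝ) ^ β) := by ring
  linarith

/-- **The one-point Gel'fond ceiling** `ν*(ξ; β, σ, τ) ≤ 1 + β`: for transcendental `ξ`, `β ≥ 1`,
`σ ≥ 0` and any `τ`, every `ν > 1 + β` is an exponent of the additive small value estimate at the
points `iξ` (already the single condition at `i = 1`, `j = 0` cannot be met for all large `n`). -/
theorem Ioi_subset_royAdditiveSVEExponents {ξ : ℂ} (hξ : Transcendental ℚ ξ) {β σ : ℝ} (τ : ℝ)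
    (hσ : 0 ≤ σ) (hβ : 1 ≤ β) :
    Set.Ioi (1 + β) ⊆ royAdditiveSVEExponents ξ β σ τ := by
  intro ν hν
  rw [Set.mem_Ioi] at hν
  by_contra hcon
  have hev : ∀ᶠ n : ℕ in atTop, (RoyAdditiveSmall ξ β σ τ ν n).Nonempty :=
    (Filter.not_frequently.mp hcon).mono fun n hn => not_not.mp hn
  obtain ⟨N₁, hN₁⟩ := Filter.eventually_atTop.mp (hev.and (eventually_ge_atTop 1))
  -- choose the polynomials (junk `0` below `N₁`)
  have hex : ∀ n : ℕ, ∃ P : ℤ[X], N₁ ≤ n → P ∈ RoyAdditiveSmall ξ β σ τ ν n := fun n => by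
    by_cases h : N₁ ≤ n
    · exact ⟨(hN₁ n h).1.some, fun _ => (hN₁ n h).1.some_mem⟩
    · exact ⟨0, fun h' => absurd h' h⟩
  choose P hP using hex
  have hPev : ∀ᶠ n : ℕ in atTop,
      P n ≠ 0 ∧ (P n).natDegree ≤ n ∧ (polyHeight (P n) : ℝ) ≤ Real.exp ((n : ℝ) ^ β) :=
    Filter.eventually_atTop.mpr ⟨N₁, fun n hn =>
      ⟨(hP n hn).1, (hP n hn).2.1, (hP n hn).2.2.1⟩⟩
  -- eventually `P n` IS small at `ξ = 1 · ξ`, order `j = 0`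
  have hsmallev : ∀ᶠ n : ℕ in atTop, ‖aeval ξ (P n)‖ ≤ Real.exp (-(n : ℝ) ^ ν) := by
    refine Filter.eventually_atTop.mpr ⟨N₁, fun n hn => ?_⟩
    obtain ⟨-, -, -, hsmall⟩ := hP n hn
    have hn1 : (1 : ℝ) ≤ n := by exact_mod_cast (hN₁ n hn).2
    have hi : ((1 : ℕ) : ℝ) ≤ (n : ℝ) ^ σ := by
      rw [Nat.cast_one]
      exact Real.one_le_rpow hn1 hσ
    have hj : ((0 : ℕ) : ℝ) ≤ (n : ℝ) ^ τ := by
      rw [Nat.cast_zero]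
      exact Real.rpow_nonneg (by linarith) τ
    have hup := hsmall 1 0 hi hj
    rwa [Nat.cast_one, one_mul, hasseDeriv_zero'] at hup
  -- contradiction with Gel'fond at one point
  obtain ⟨n, hlt, hle⟩ :=
    ((frequently_not_small_at_point hξ hβ hν P hPev).and_eventually hsmallev).exists
  exact absurd (hlt.trans_le hle) (lt_irrefl _)

/-! ## §3 Consequences for the node `RoyAdditiveDirichletExponent` -/

/-- **The node holds at its corner `σ = τ = 0`**: this is `RoyAdditiveDirichletExponent` with the
two extra hypotheses `σ = 0`, `τ = 0` — there the Dirichlet floor `1 + β − σ − τ` and the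
one-point Gel'fond ceiling `1 + β` coincide. -/
theorem royAdditiveDirichletExponent_corner :
    ∀ ξ : ℂ, Transcendental ℚ ξ → ∀ β σ τ : ℝ, 0 ≤ σ → 0 ≤ τ → 1 < β → σ + τ < 1 →
      σ = 0 → τ = 0 → Set.Ioi (1 + β - σ - τ) ⊆ royAdditiveSVEExponents ξ β σ τ := by
  intro ξ hξ β σ τ hσ hτ hβ _ hσ0 hτ0
  subst hσ0; subst hτ0
  rw [sub_zero, sub_zero]
  exact Ioi_subset_royAdditiveSVEExponents hξ 0 le_rfl hβ.le

/-- At the corner the exponent set of a transcendental `ξ` is pinned: `(1 + β, ∞) ⊆ E ⊆ [1 + β, ∞)`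
(`β > 1`; whether the endpoint `1 + β` itself belongs is not decided here). -/
theorem royAdditiveSVEExponents_corner_eq {ξ : ℂ} (hξ : Transcendental ℚ ξ) {β : ℝ} (hβ : 1 < β) :
    Set.Ioi (1 + β) ⊆ royAdditiveSVEExponents ξ β 0 0 ∧
      royAdditiveSVEExponents ξ β 0 0 ⊆ Set.Ici (1 + β) := by
  refine ⟨Ioi_subset_royAdditiveSVEExponents hξ 0 le_rfl hβ.le, ?_⟩
  have h := royAdditiveSVEExponents_subset_Ici ξ (β := β) (σ := 0) (τ := 0) le_rfl le_rfl
    (by norm_num) (by linarith)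
  simpa using h

/-- **The kernel window**: for transcendental `ξ`, `β > 1`, `σ, τ ≥ 0`, `σ + τ < 1`, the threshold
lies in `[1 + β − σ − τ, 1 + β]` — `(1 + β, ∞) ⊆ royAdditiveSVEExponents ξ β σ τ ⊆ [1 + β − σ − τ, ∞)`
(Dirichlet floor of `SoloInformedRoyAdditiveDirichlet`, Gel'fond ceiling of §2).  The node
`RoyAdditiveDirichletExponent` asserts the left end; [Roy2010, Thm 1.1 (3)] (not in the tree)
gives `(1 + β − (3/4)σ − τ, ∞)`. -/
theorem royAdditiveSVEExponents_window {ξ : ℂ} (hξ : Transcendental ℚ ξ) {β σ τ : ℝ}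
    (hσ : 0 ≤ σ) (hτ : 0 ≤ τ) (hβ : 1 < β) (hστ : σ + τ < 1) :
    Set.Ioi (1 + β) ⊆ royAdditiveSVEExponents ξ β σ τ ∧
      royAdditiveSVEExponents ξ β σ τ ⊆ Set.Ici (1 + β - σ - τ) :=
  ⟨Ioi_subset_royAdditiveSVEExponents hξ τ hσ hβ.le,
    royAdditiveSVEExponents_subset_Ici ξ hσ hτ hστ (by linarith)⟩

/-- The node is equivalent to its restriction to `(σ, τ) ≠ (0, 0)`: the corner is settled. -/
theorem royAdditiveDirichletExponent_iff_off_corner :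
    RoyAdditiveDirichletExponent ↔
      ∀ ξ : ℂ, Transcendental ℚ ξ → ∀ β σ τ : ℝ, 0 ≤ σ → 0 ≤ τ → 1 < β → σ + τ < 1 →
        (σ, τ) ≠ (0, 0) → Set.Ioi (1 + β - σ - τ) ⊆ royAdditiveSVEExponents ξ β σ τ := by
  refine ⟨fun h ξ hξ β σ τ hσ hτ hβ hστ _ => h ξ hξ β σ τ hσ hτ hβ hστ,
    fun h ξ hξ β σ τ hσ hτ hβ hστ => ?_⟩
  by_cases hc : (σ, τ) = (0, 0)
  · obtain ⟨rfl, rfl⟩ := Prod.mk.injEq _ _ _ _ ▸ hc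
    exact royAdditiveDirichletExponent_corner ξ hξ β 0 0 hσ hτ hβ hστ rfl rfl
  · exact h ξ hξ β σ τ hσ hτ hβ hστ hc

end Summit.Schanuel.Schanuel.Theorems
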